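import Literature.Analysis.FluidPDE.ClassicalNSModeCompactness
import Literature.Analysis.FunctionSpaces.TorusSpaceTimeL3Cauchy
import HarnessLib

/-!
# Stub `stub_krCellCauchy` (H1–H2) of the plan for `stub_kolmogorovRieszPeriodicSlab`
(line `tight`, crux `EulerLimit.EulerlimitThesisV2`, stmt-AnomalousDissipation-0511)

**`L³(0,T)`-Cauchy sequences from a uniform integral modulus of continuity and convergent cell
averages** — the time-direction step of the Kolmogorov–M. Riesz–Fréchet / Simon compactness
criterion (Simon 1987, §8, Thm. 5: a bounded family in `L^p(0,T;B)` with relatively compact window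
integrals and `‖τ_σ f - f‖_{L^p} → 0` uniformly as `σ → 0` is relatively compact), in the
elementary quantitative form of the tree's `TimePartitionIncrements` / `TimeIncrementsL3Cauchy`
(which assume instead increments controlled by `L¹` rates, `‖F(t) - F(s)‖ ≤ ∫ₛᵗ g`):

* `lintegral_enorm_pow_three_le_of_modulus` (H1): for continuous `F : ℝ → E`, `h = T/(L+1)` and the
  cells `I_l = (l h, (l+1) h)`,
  `∫₀ᵀ ‖F‖³ ≤ 4 h⁻² ∑_l ‖∫_{I_l} F‖³ + 32 Λ` whenever `∫₀ᵀ ‖F(· + σ) - F‖³ ≤ Λ` for all `|σ| ≤ h`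
  (in the cell, `h F(t) - ∫_{I_l} F = ∫_{I_l} (F(t) - F(s)) ds`, whose norm is at most
  `∫_{-h}^{h} ‖F(t+σ) - F(t)‖ dσ`; Jensen and Tonelli);
* `exists_forall_lintegral_enorm_sub_pow_three_le_of_modulus` (H2): a sequence `F_n` with a UNIFORM
  modulus and convergent cell averages over every uniform partition is Cauchy in `L³(0,T;E)`.

Generic in the Banach space `E`; the file ends with the REGISTERED sub-stub `stub_krCellCauchy`
(`E = ℂ³` as `EuclideanSpace ℂ (Fin 3)`, the Fourier modes of `stub_krTimeModesCauchy`),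
signature verbatim.
-/

noncomputable section

-- D-0017: single-problem summit ⇒ the duplicated namespace segment is by design.
set_option linter.dupNamespace false

open MeasureTheory Set Function Filter
open scoped ENNReal NNReal Topology

namespace Summit.AnomalousDissipation.AnomalousDissipation.Theorems.EulerLimitKR

open Literature.Analysis.FunctionSpaces

/-! ## Elementary tools -/

section Elementary

/-- `(a + b)³ ≤ 4 a³ + 4 b³` in `ℝ≥0∞` (convexity of the cube; private copy of the equally private
lemma of `TimePartitionIncrements`). [folklore] -/
private theorem ennreal_add_pow_three_le (a b : ℝ≥0∞) : (a + b) ^ 3 ≤ 4 * a ^ 3 + 4 * b ^ 3 := by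
  have h := ENNReal.rpow_add_le_mul_rpow_add_rpow a b (by norm_num : (1 : ℝ) ≤ 3)
  have e : ∀ x : ℝ≥0∞, x ^ (3 : ℝ) = x ^ 3 := fun x => by
    rw [show (3 : ℝ) = ((3 : ℕ) : ℝ) by norm_num, ENNReal.rpow_natCast]
  have e2 : (2 : ℝ≥0∞) ^ ((3 : ℝ) - 1) = 4 := by
    rw [show (3 : ℝ) - 1 = ((2 : ℕ) : ℝ) by norm_num, ENNReal.rpow_natCast]
    norm_num
  rw [e, e, e, e2, mul_add] at h
  exact h

/-- Jensen on a symmetric interval: `(∫_{(-h,h)} g)³ ≤ (2h)² ∫_{(-h,h)} g³` (Hölder against the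
constant weight, `Literature.Analysis.UnboundedOperators.lintegral_mul_rpow_le_of_one_le`). [folklore] -/
private theorem lintegral_Ioo_pow_three_le {h : ℝ} {g : ℝ → ℝ≥0∞}
    (hg : AEMeasurable g (volume.restrict (Ioo (-h) h))) :
    (∫⁻ σ in Ioo (-h) h, g σ) ^ 3 ≤ ENNReal.ofReal (2 * h) ^ 2 * ∫⁻ σ in Ioo (-h) h, g σ ^ 3 := by
  have hJ := Literature.Analysis.UnboundedOperators.lintegral_mul_rpow_le_of_one_le
    (μ := volume.restrict (Ioo (-h) h)) (K := fun _ => 1) (F := g) aemeasurable_const hg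
    (by norm_num : (1 : ℝ) ≤ 3)
  have e3 : ∀ x : ℝ≥0∞, x ^ (3 : ℝ) = x ^ 3 := fun x => by
    rw [show (3 : ℝ) = ((3 : ℕ) : ℝ) by norm_num, ENNReal.rpow_natCast]
  have e2 : ∀ x : ℝ≥0∞, x ^ ((3 : ℝ) - 1) = x ^ 2 := fun x => by
    rw [show (3 : ℝ) - 1 = ((2 : ℕ) : ℝ) by norm_num, ENNReal.rpow_natCast]
  have hvol : ∫⁻ _σ in Ioo (-h) h, (1 : ℝ≥0∞) = ENNReal.ofReal (2 * h) := by
    rw [setLIntegral_const, Real.volume_Ioo, one_mul]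
    congr 1
    ring
  rw [e2] at hJ
  simp only [one_mul, e3] at hJ
  rwa [hvol] at hJ

/-- Translation of a set lower integral on `ℝ`: `∫_{(-h,h)} G(t + σ) dσ = ∫_{(t-h,t+h)} G`. [folklore] -/
private theorem setLIntegral_Ioo_comp_add (G : ℝ → ℝ≥0∞) (t h : ℝ) :
    ∫⁻ σ in Ioo (-h) h, G (t + σ) = ∫⁻ s in Ioo (t - h) (t + h), G s := by
  have h1 := (measurePreserving_add_left volume t).setLIntegral_comp_preimage_emb
    (MeasurableEquiv.addLeft t).measurableEmbedding G (Ioo (t - h) (t + h))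
  rw [Set.preimage_const_add_Ioo, show t - h - t = -h by ring, show t + h - t = h by ring] at h1
  exact h1

/-- **In a cell the values are controlled by the cell average and the local modulus**: for
continuous `F`, `h > 0` and `t ∈ I = (a, a + h)`,
`h ‖F t‖ ≤ ‖∫_I F‖ + ∫_{(-h,h)} ‖F(t + σ) - F(t)‖ dσ`
(`h F(t) - ∫_I F = ∫_I (F(t) - F(s)) ds` and `I - t ⊆ (-h, h)`). [folklore] -/
private theorem ofReal_mul_enorm_le {E : Type*} [NormedAddCommGroup E] [NormedSpace ℝ E]
    [CompleteSpace E] {F : ℝ → E} (hF : Continuous F) {a h : ℝ} (hh : 0 < h) {t : ℝ}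
    (ht : t ∈ Ioo a (a + h)) :
    ENNReal.ofReal h * ‖F t‖ₑ ≤
      ‖∫ s in Ioo a (a + h), F s‖ₑ + ∫⁻ σ in Ioo (-h) h, ‖F (t + σ) - F t‖ₑ := by
  set I : Set ℝ := Ioo a (a + h) with hI
  have hvol : volume I = ENNReal.ofReal h := by
    rw [hI, Real.volume_Ioo]
    congr 1
    ring
  have hvol' : volume.real I = h := by rw [measureReal_def, hvol, ENNReal.toReal_ofReal hh.le]
  have hfin : volume I < ∞ := by rw [hvol]; exact ENNReal.ofReal_lt_top
  have hFi : IntegrableOn F I := (hF.integrableOn_Icc).mono_set Ioo_subset_Icc_self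
  have hc : IntegrableOn (fun _ : ℝ => F t) I := integrableOn_const hfin.ne
  have e1 : ∫ s in I, (F t - F s) = h • F t - ∫ s in I, F s := by
    rw [integral_sub hc hFi, setIntegral_const, hvol']
  have h1 : ENNReal.ofReal h * ‖F t‖ₑ = ‖h • F t‖ₑ := by
    rw [enorm_smul, Real.enorm_of_nonneg hh.le]
  have h2 : ‖h • F t‖ₑ ≤ ‖∫ s in I, F s‖ₑ + ‖∫ s in I, (F t - F s)‖ₑ := by
    rw [e1]
    calc ‖h • F t‖ₑ = ‖(∫ s in I, F s) + (h • F t - ∫ s in I, F s)‖ₑ := by rw [add_sub_cancel]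
      _ ≤ ‖∫ s in I, F s‖ₑ + ‖h • F t - ∫ s in I, F s‖ₑ := enorm_add_le _ _
  have h3 : ‖∫ s in I, (F t - F s)‖ₑ ≤ ∫⁻ s in I, ‖F t - F s‖ₑ := enorm_integral_le_lintegral_enorm _
  have h4 : ∫⁻ s in I, ‖F t - F s‖ₑ ≤ ∫⁻ s in Ioo (t - h) (t + h), ‖F s - F t‖ₑ := by
    calc ∫⁻ s in I, ‖F t - F s‖ₑ = ∫⁻ s in I, ‖F s - F t‖ₑ := lintegral_congr fun s => enorm_sub_rev _ _
      _ ≤ ∫⁻ s in Ioo (t - h) (t + h), ‖F s - F t‖ₑ :=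
          lintegral_mono_set (Ioo_subset_Ioo (by linarith [ht.2]) (by linarith [ht.1]))
  have h5 : ∫⁻ s in Ioo (t - h) (t + h), ‖F s - F t‖ₑ = ∫⁻ σ in Ioo (-h) h, ‖F (t + σ) - F t‖ₑ :=
    (setLIntegral_Ioo_comp_add (fun s => ‖F s - F t‖ₑ) t h).symm
  rw [h1]
  exact h2.trans (add_le_add le_rfl (h3.trans (h4.trans h5.le)))

end Elementary

/-! ## H1: the `L³(0,T)` bound from cell averages and an integral modulus -/

section CellBound

variable {E : Type*} [NormedAddCommGroup E] [NormedSpace ℝ E] [CompleteSpace E]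

/-- **`L³(0,T)` bound from cell averages and an integral modulus of continuity (H1)** (the
time-direction step of Simon 1987, §8, Thm. 5, made quantitative; modulus analogue of
`Literature.Analysis.FunctionSpaces.lintegral_enorm_pow_three_le_of_increments`).  Let `F : ℝ → E`
be continuous, `T > 0`, `L ∈ ℕ`, `h = T/(L+1)`, and suppose `∫₀ᵀ ‖F(t + σ) - F(t)‖³ dt ≤ Λ` for all
`|σ| ≤ h`.  Then, with the cells `I_l = (l h, (l+1) h)`, `l = 0, …, L`,
`∫₀ᵀ ‖F‖³ ≤ 4 h⁻² ∑_l ‖∫_{I_l} F‖³ + 32 Λ`.  Proof: for `t ∈ I_l`,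
`h ‖F(t)‖ ≤ ‖∫_{I_l} F‖ + ∫_{(-h,h)} ‖F(t+σ) - F(t)‖ dσ` (`ofReal_mul_enorm_le`), cube with
`(a+b)³ ≤ 4a³ + 4b³` and Jensen `(∫_{(-h,h)} g)³ ≤ (2h)² ∫_{(-h,h)} g³`, integrate in `t`, swap the
integrals (Tonelli) and use the modulus bound for each `σ ∈ (-h, h)`. [cite: Simon1986, §8 Thm. 5] -/
theorem lintegral_enorm_pow_three_le_of_modulus {T : ℝ} (hT : 0 < T) {F : ℝ → E}
    (hF : Continuous F) (L : ℕ) {Λ : ℝ≥0∞}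
    (hmod : ∀ σ : ℝ, |σ| ≤ T / (L + 1) → ∫⁻ t in Ioo 0 T, ‖F (t + σ) - F t‖ₑ ^ 3 ≤ Λ) :
    ∫⁻ t in Ioo 0 T, ‖F t‖ₑ ^ 3 ≤
      4 * ENNReal.ofReal ((L + 1 : ℝ) / T) ^ 2 *
          ∑ l ∈ Finset.range (L + 1),
            ‖∫ t in Ioo ((l : ℝ) * (T / (L + 1))) ((l + 1 : ℝ) * (T / (L + 1))), F t‖ₑ ^ 3 +
        32 * Λ := by
  -- the partition
  set n : ℕ := L + 1 with hn
  have hnR : (n : ℝ) = L + 1 := by rw [hn]; push_cast; ring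
  set h : ℝ := T / (L + 1) with hh
  have hh0 : 0 < h := by rw [hh]; positivity
  have hnh : (n : ℝ) * h = T := by rw [hnR, hh]; field_simp
  have hinvh : (L + 1 : ℝ) / T = h⁻¹ := by rw [hh, inv_div]
  set I : ℕ → Set ℝ := fun l => Ioo ((l : ℝ) * h) ((l + 1 : ℝ) * h) with hI
  have hIvol : ∀ l, volume (I l) = ENNReal.ofReal h := by
    intro l
    rw [hI]
    simp only [Real.volume_Ioo]
    congr 1
    ring
  set A : ℕ → E := fun l => ∫ t in I l, F t with hA
  have hhinv : (ENNReal.ofReal h)⁻¹ * ENNReal.ofReal h = 1 :=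
    ENNReal.inv_mul_cancel (ENNReal.ofReal_pos.2 hh0).ne' ENNReal.ofReal_ne_top
  have h2h : ENNReal.ofReal (2 * h) = 2 * ENNReal.ofReal h := by
    rw [ENNReal.ofReal_mul zero_le_two, ENNReal.ofReal_ofNat]
  -- the modulus integrand is jointly measurable
  have hGc : Continuous fun p : ℝ × ℝ => F (p.1 + p.2) - F p.1 :=
    (hF.comp (continuous_fst.add continuous_snd)).sub (hF.comp continuous_fst)
  have hGm : Measurable fun p : ℝ × ℝ => ‖F (p.1 + p.2) - F p.1‖ₑ ^ 3 :=
    ((ENNReal.continuous_pow 3).comp hGc.enorm).measurable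
  -- pointwise bound inside a cell, cubed
  set c : ℕ → ℝ≥0∞ := fun l => 4 * (‖A l‖ₑ * (ENNReal.ofReal h)⁻¹) ^ 3 with hc
  have hpt : ∀ l : ℕ, ∀ t ∈ I l, ‖F t‖ₑ ^ 3 ≤
      c l + 16 * (ENNReal.ofReal h)⁻¹ * ∫⁻ σ in Ioo (-h) h, ‖F (t + σ) - F t‖ₑ ^ 3 := by
    intro l t ht
    have hcell : (l + 1 : ℝ) * h = (l : ℝ) * h + h := by ring
    have ht' : t ∈ Ioo ((l : ℝ) * h) ((l : ℝ) * h + h) := by rw [← hcell]; exact ht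
    have h1 := ofReal_mul_enorm_le hF hh0 ht'
    rw [← hcell] at h1
    set D : ℝ≥0∞ := ∫⁻ σ in Ioo (-h) h, ‖F (t + σ) - F t‖ₑ with hD
    set M : ℝ≥0∞ := ∫⁻ σ in Ioo (-h) h, ‖F (t + σ) - F t‖ₑ ^ 3 with hM
    have h2 : ‖F t‖ₑ ≤ ‖A l‖ₑ * (ENNReal.ofReal h)⁻¹ + (ENNReal.ofReal h)⁻¹ * D := by
      calc ‖F t‖ₑ = (ENNReal.ofReal h)⁻¹ * (ENNReal.ofReal h * ‖F t‖ₑ) := by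
            rw [← mul_assoc, hhinv, one_mul]
        _ ≤ (ENNReal.ofReal h)⁻¹ * (‖A l‖ₑ + D) := by gcongr
        _ = ‖A l‖ₑ * (ENNReal.ofReal h)⁻¹ + (ENNReal.ofReal h)⁻¹ * D := by ring
    have hDm : AEMeasurable (fun σ => ‖F (t + σ) - F t‖ₑ) (volume.restrict (Ioo (-h) h)) :=
      ((hF.comp (continuous_const.add continuous_id)).sub continuous_const).enorm.measurable.aemeasurable
    have hJ : D ^ 3 ≤ ENNReal.ofReal (2 * h) ^ 2 * M := lintegral_Ioo_pow_three_le hDm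
    calc ‖F t‖ₑ ^ 3 ≤ (‖A l‖ₑ * (ENNReal.ofReal h)⁻¹ + (ENNReal.ofReal h)⁻¹ * D) ^ 3 := by gcongr
      _ ≤ 4 * (‖A l‖ₑ * (ENNReal.ofReal h)⁻¹) ^ 3 + 4 * ((ENNReal.ofReal h)⁻¹ * D) ^ 3 :=
          ennreal_add_pow_three_le _ _
      _ = c l + 4 * (ENNReal.ofReal h)⁻¹ ^ 3 * D ^ 3 := by
          simp only [hc]
          ring
      _ ≤ c l + 4 * (ENNReal.ofReal h)⁻¹ ^ 3 * (ENNReal.ofReal (2 * h) ^ 2 * M) := by gcongr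
      _ = c l + 16 * (ENNReal.ofReal h)⁻¹ * M * ((ENNReal.ofReal h)⁻¹ * ENNReal.ofReal h) ^ 2 := by
          rw [h2h]
          ring
      _ = c l + 16 * (ENNReal.ofReal h)⁻¹ * M := by rw [hhinv, one_pow, mul_one]
  -- a.e. `t ∈ (0,T)` lies in a cell
  have hae : ∀ᵐ t ∂(volume.restrict (Ioo 0 T)),
      ‖F t‖ₑ ^ 3 ≤ (∑ l ∈ Finset.range n, (I l).indicator (fun _ => c l) t) +
        16 * (ENNReal.ofReal h)⁻¹ * ∫⁻ σ in Ioo (-h) h, ‖F (t + σ) - F t‖ₑ ^ 3 := by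
    set P : Set ℝ := (fun l : ℕ => (l : ℝ) * h) '' (Finset.range (n + 1) : Set ℕ) with hP
    have hPfin : P.Finite := (Finset.finite_toSet _).image _
    have hP0 : ∀ᵐ t ∂(volume : Measure ℝ), t ∉ P :=
      measure_eq_zero_iff_ae_notMem.1 (hPfin.measure_zero volume)
    filter_upwards [ae_restrict_of_ae hP0, ae_restrict_mem measurableSet_Ioo] with t htP ht
    have hP' : ∀ l : ℕ, l ≤ n → t ≠ (l : ℝ) * h := by
      intro l hl heq
      exact htP ⟨l, by simpa [Nat.lt_succ_iff] using hl, heq.symm⟩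
    obtain ⟨l₀, hl₀, htl₀⟩ := exists_mem_Ioo_cell hh0 hnh ht hP'
    calc ‖F t‖ₑ ^ 3 ≤ c l₀ + 16 * (ENNReal.ofReal h)⁻¹ * ∫⁻ σ in Ioo (-h) h, ‖F (t + σ) - F t‖ₑ ^ 3 :=
          hpt l₀ t htl₀
      _ = (I l₀).indicator (fun _ => c l₀) t +
            16 * (ENNReal.ofReal h)⁻¹ * ∫⁻ σ in Ioo (-h) h, ‖F (t + σ) - F t‖ₑ ^ 3 := by
          rw [indicator_of_mem htl₀]
      _ ≤ _ := by
          gcongr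
          exact Finset.single_le_sum (f := fun l => (I l).indicator (fun _ => c l) t)
            (fun l _ => zero_le) (Finset.mem_range.2 hl₀)
  -- integrate: the cell term
  have hmeasS : Measurable fun t => ∑ l ∈ Finset.range n, (I l).indicator (fun _ => c l) t :=
    Finset.measurable_sum _ fun l _ => measurable_const.indicator measurableSet_Ioo
  have hint1 : ∫⁻ t in Ioo 0 T, ∑ l ∈ Finset.range n, (I l).indicator (fun _ => c l) t ≤
      4 * (ENNReal.ofReal h)⁻¹ ^ 2 * ∑ l ∈ Finset.range n, ‖A l‖ₑ ^ 3 := by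
    rw [lintegral_finsetSum _ fun l _ => (measurable_const.indicator measurableSet_Ioo), Finset.mul_sum]
    refine Finset.sum_le_sum fun l _ => ?_
    rw [lintegral_indicator_const measurableSet_Ioo]
    calc c l * (volume.restrict (Ioo 0 T)) (I l) ≤ c l * volume (I l) := by
          gcongr
          exact Measure.restrict_le_self
      _ = 4 * (ENNReal.ofReal h)⁻¹ ^ 2 * ‖A l‖ₑ ^ 3 * ((ENNReal.ofReal h)⁻¹ * ENNReal.ofReal h) := by
          rw [hIvol l, hc]
          ring
      _ = 4 * (ENNReal.ofReal h)⁻¹ ^ 2 * ‖A l‖ₑ ^ 3 := by rw [hhinv, mul_one]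
  -- integrate: the modulus term (Tonelli and the hypothesis)
  have hint2 : ∫⁻ t in Ioo 0 T, ∫⁻ σ in Ioo (-h) h, ‖F (t + σ) - F t‖ₑ ^ 3 ≤
      ENNReal.ofReal (2 * h) * Λ := by
    rw [lintegral_lintegral_swap (hGm.aemeasurable :)]
    calc ∫⁻ σ in Ioo (-h) h, ∫⁻ t in Ioo 0 T, ‖F (t + σ) - F t‖ₑ ^ 3
        ≤ ∫⁻ _σ in Ioo (-h) h, Λ :=
          setLIntegral_mono' measurableSet_Ioo fun σ hσ => hmod σ (abs_le.2 ⟨hσ.1.le, hσ.2.le⟩)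
      _ = ENNReal.ofReal (2 * h) * Λ := by
          rw [setLIntegral_const, Real.volume_Ioo, mul_comm]
          congr 2
          ring
  -- assemble
  have htop : (16 : ℝ≥0∞) * (ENNReal.ofReal h)⁻¹ ≠ ⊤ :=
    ENNReal.mul_ne_top (by norm_num) (ENNReal.inv_ne_top.2 (ENNReal.ofReal_pos.2 hh0).ne')
  calc ∫⁻ t in Ioo 0 T, ‖F t‖ₑ ^ 3
      ≤ ∫⁻ t in Ioo 0 T, ((∑ l ∈ Finset.range n, (I l).indicator (fun _ => c l) t) +
          16 * (ENNReal.ofReal h)⁻¹ * ∫⁻ σ in Ioo (-h) h, ‖F (t + σ) - F t‖ₑ ^ 3) :=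
        lintegral_mono_ae hae
    _ = (∫⁻ t in Ioo 0 T, ∑ l ∈ Finset.range n, (I l).indicator (fun _ => c l) t) +
          16 * (ENNReal.ofReal h)⁻¹ * ∫⁻ t in Ioo 0 T, ∫⁻ σ in Ioo (-h) h, ‖F (t + σ) - F t‖ₑ ^ 3 := by
        rw [lintegral_add_left hmeasS, lintegral_const_mul' _ _ htop]
    _ ≤ 4 * (ENNReal.ofReal h)⁻¹ ^ 2 * ∑ l ∈ Finset.range n, ‖A l‖ₑ ^ 3 +
          16 * (ENNReal.ofReal h)⁻¹ * (ENNReal.ofReal (2 * h) * Λ) := add_le_add hint1 (by gcongr)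
    _ = 4 * (ENNReal.ofReal h)⁻¹ ^ 2 * ∑ l ∈ Finset.range n, ‖A l‖ₑ ^ 3 +
          32 * Λ * ((ENNReal.ofReal h)⁻¹ * ENNReal.ofReal h) := by
        rw [h2h]
        ring
    _ = _ := by rw [hhinv, mul_one, hinvh, ENNReal.ofReal_inv_of_pos hh0]

end CellBound

/-! ## H2: the Cauchy property from a uniform modulus and convergent cell averages -/

section CellCauchy

variable {E : Type*} [NormedAddCommGroup E] [NormedSpace ℝ E] [CompleteSpace E]

/-- **`L³(0,T)`-Cauchy property from a uniform modulus and convergent cell averages (H2)** (Simon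
1987, §8, Thm. 5, sufficiency, quantitative form; modulus analogue of
`Literature.Analysis.FunctionSpaces.exists_forall_lintegral_enorm_sub_pow_three_le_of_increments`).
Let `F_n : ℝ → E` be continuous with a modulus of continuity in `L³(0,T)` that is uniform in `n`
(`∀ Λ > 0 ∃ δ > 0 ∀ n ∀ |σ| ≤ δ, ∫₀ᵀ ‖F_n(t+σ) - F_n(t)‖³ ≤ Λ`), and assume that every cell average
`∫_{I_l} F_n` over every uniform partition of `(0,T)` converges as `n → ∞`.  Then for every `η > 0`
there is `N` with `∫₀ᵀ ‖F_n - F_m‖³ ≤ η` for all `n, m ≥ N` (H1 for `F_n - F_m`, whose modulus at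
scales `≤ δ` is `≤ 8 Λ`, on a partition with `T/(L+1) ≤ δ`; then the finitely many cell averages of
the difference tend to zero). [cite: Simon1986, §8 Thm. 5] -/
theorem exists_forall_lintegral_enorm_sub_pow_three_le_of_modulus {T : ℝ} (hT : 0 < T)
    {F : ℕ → ℝ → E} (hF : ∀ n, Continuous (F n))
    (hmod : ∀ Λ : ℝ≥0∞, 0 < Λ → ∃ δ : ℝ, 0 < δ ∧ ∀ (n : ℕ) (σ : ℝ), |σ| ≤ δ →
      ∫⁻ t in Ioo 0 T, ‖F n (t + σ) - F n t‖ₑ ^ 3 ≤ Λ)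
    (havg : ∀ L l : ℕ, l ≤ L → ∃ c : E, Tendsto
      (fun n => ∫ t in Ioo ((l : ℝ) * (T / (L + 1))) ((l + 1 : ℝ) * (T / (L + 1))), F n t)
        atTop (𝓝 c))
    {η : ℝ≥0∞} (hη : 0 < η) :
    ∃ N : ℕ, ∀ n m : ℕ, N ≤ n → N ≤ m → ∫⁻ t in Ioo 0 T, ‖F n t - F m t‖ₑ ^ 3 ≤ η := by
  have hη2 : 0 < η / 2 := ENNReal.half_pos hη.ne'
  -- Step 1: the modulus scale `δ` and the number of cells
  set Λ' : ℝ≥0∞ := η / 2 / 256 with hΛ'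
  have hΛ'pos : 0 < Λ' := ENNReal.div_pos hη2.ne' (by norm_num)
  obtain ⟨δ, hδ, hδmod⟩ := hmod Λ' hΛ'pos
  obtain ⟨L, hL⟩ : ∃ L : ℕ, T / (L + 1) ≤ δ := by
    obtain ⟨L, hL⟩ := exists_nat_gt (T / δ)
    refine ⟨L, ?_⟩
    rw [div_le_iff₀ (by positivity)]
    have h1 : T < L * δ := (div_lt_iff₀ hδ).1 hL
    nlinarith
  -- notation for the cells of this partition
  set h : ℝ := T / (L + 1) with hh
  have hh0 : 0 < h := by rw [hh]; positivity
  set I : ℕ → Set ℝ := fun l => Ioo ((l : ℝ) * h) ((l + 1 : ℝ) * h) with hI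
  have hFi : ∀ k l, IntegrableOn (F k) (I l) := fun k l =>
    ((hF k).integrableOn_Icc).mono_set Ioo_subset_Icc_self
  -- Step 2: the cell averages of `F n - F m` tend to zero jointly in `(n, m)`
  set a : ℕ → ℕ → E := fun n l => ∫ t in I l, F n t with ha
  have havg' : ∀ l, l < L + 1 → Tendsto (fun p : ℕ × ℕ => a p.1 l - a p.2 l) atTop (𝓝 0) := by
    intro l hl
    obtain ⟨c, hc⟩ := havg L l (Nat.lt_succ_iff.1 hl)
    exact tendsto_sub_atTop_prod_of_tendsto hc
  set C : ℝ≥0∞ := 4 * ENNReal.ofReal ((L + 1 : ℝ) / T) ^ 2 with hC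
  have hCtop : C ≠ ⊤ := ENNReal.mul_ne_top (by norm_num) (ENNReal.pow_ne_top ENNReal.ofReal_ne_top)
  have hsum : Tendsto (fun p : ℕ × ℕ => C * ∑ l ∈ Finset.range (L + 1), ‖a p.1 l - a p.2 l‖ₑ ^ 3)
      atTop (𝓝 0) := by
    have h1 : ∀ l ∈ Finset.range (L + 1),
        Tendsto (fun p : ℕ × ℕ => ‖a p.1 l - a p.2 l‖ₑ ^ 3) atTop (𝓝 0) := by
      intro l hl
      have h2 : Tendsto (fun p : ℕ × ℕ => ‖a p.1 l - a p.2 l‖ₑ) atTop (𝓝 0) := by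
        simpa using (havg' l (Finset.mem_range.1 hl)).enorm
      have h3 := ((ENNReal.continuous_pow 3).tendsto 0).comp h2
      simpa [Function.comp_def] using h3
    have h4 : Tendsto (fun p : ℕ × ℕ => ∑ l ∈ Finset.range (L + 1), ‖a p.1 l - a p.2 l‖ₑ ^ 3)
        atTop (𝓝 0) := by
      simpa using tendsto_finsetSum (Finset.range (L + 1)) h1
    simpa using ENNReal.Tendsto.const_mul h4 (Or.inr hCtop)
  obtain ⟨N₀, hN₀⟩ := eventually_atTop.1 (hsum.eventually (gt_mem_nhds hη2))
  refine ⟨max N₀.1 N₀.2, fun n m hn hm => ?_⟩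
  have hNp : N₀ ≤ (n, m) := ⟨(le_max_left _ _).trans hn, (le_max_right _ _).trans hm⟩
  -- Step 3: H1 for `F n - F m`, whose modulus at scales `≤ h ≤ δ` is at most `8 Λ'`
  have hG : Continuous fun t => F n t - F m t := (hF n).sub (hF m)
  have hmodG : ∀ σ : ℝ, |σ| ≤ T / (L + 1) →
      ∫⁻ t in Ioo 0 T, ‖(F n (t + σ) - F m (t + σ)) - (F n t - F m t)‖ₑ ^ 3 ≤ 8 * Λ' := by
    intro σ hσ
    have hσδ : |σ| ≤ δ := hσ.trans hL
    have e : ∀ t, (F n (t + σ) - F m (t + σ)) - (F n t - F m t) =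
        (F n (t + σ) - F n t) - (F m (t + σ) - F m t) := fun t => by abel
    have hmeas : Measurable fun t => 4 * ‖F n (t + σ) - F n t‖ₑ ^ 3 :=
      (((hF n).comp (continuous_id.add continuous_const)).sub (hF n)).enorm.measurable.pow_const
        3 |>.const_mul 4
    calc ∫⁻ t in Ioo 0 T, ‖(F n (t + σ) - F m (t + σ)) - (F n t - F m t)‖ₑ ^ 3
        ≤ ∫⁻ t in Ioo 0 T, (4 * ‖F n (t + σ) - F n t‖ₑ ^ 3 + 4 * ‖F m (t + σ) - F m t‖ₑ ^ 3) := by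
          refine lintegral_mono fun t => ?_
          rw [e t]
          exact (pow_le_pow_left' enorm_sub_le 3).trans (ennreal_add_pow_three_le _ _)
      _ = (4 * ∫⁻ t in Ioo 0 T, ‖F n (t + σ) - F n t‖ₑ ^ 3) +
            4 * ∫⁻ t in Ioo 0 T, ‖F m (t + σ) - F m t‖ₑ ^ 3 := by
          rw [lintegral_add_left hmeas, lintegral_const_mul' _ _ (by norm_num),
            lintegral_const_mul' _ _ (by norm_num)]
      _ ≤ 4 * Λ' + 4 * Λ' := by gcongr <;> exact hδmod _ σ hσδ
      _ = 8 * Λ' := by rw [← add_mul]; norm_num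
  have key := lintegral_enorm_pow_three_le_of_modulus hT hG L hmodG
  -- the cell averages of the difference
  have hcellavg : ∀ l ∈ Finset.range (L + 1),
      ∫ t in Ioo ((l : ℝ) * (T / (L + 1))) ((l + 1 : ℝ) * (T / (L + 1))), (F n t - F m t) =
        a n l - a m l := fun l _ => integral_sub (hFi n l) (hFi m l)
  have hfirst : C * ∑ l ∈ Finset.range (L + 1),
      ‖∫ t in Ioo ((l : ℝ) * (T / (L + 1))) ((l + 1 : ℝ) * (T / (L + 1))), (F n t - F m t)‖ₑ ^ 3
        < η / 2 := by
    have := hN₀ (n, m) hNp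
    rw [Finset.sum_congr rfl fun l hl => by rw [hcellavg l hl]]
    exact this
  have hsecond : (32 : ℝ≥0∞) * (8 * Λ') = η / 2 := by
    rw [hΛ', ← mul_assoc, show (32 : ℝ≥0∞) * 8 = 256 by norm_num]
    exact ENNReal.mul_div_cancel (by norm_num) (by norm_num)
  calc ∫⁻ t in Ioo 0 T, ‖F n t - F m t‖ₑ ^ 3
      ≤ C * ∑ l ∈ Finset.range (L + 1),
          ‖∫ t in Ioo ((l : ℝ) * (T / (L + 1))) ((l + 1 : ℝ) * (T / (L + 1))), (F n t - F m t)‖ₑ ^ 3 +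
        32 * (8 * Λ') := key
    _ ≤ η / 2 + η / 2 := add_le_add hfirst.le hsecond.le
    _ = η := ENNReal.add_halves η

end CellCauchy

/-- **Registered sub-stub `stub_krCellCauchy`** (H2 of the STUB-PLAN for
`stub_kolmogorovRieszPeriodicSlab`, at `E = ℂ³`, the target of the Fourier modes): `L³(0,T)`-Cauchy
from a uniform integral modulus of continuity and convergent cell averages
(`exists_forall_lintegral_enorm_sub_pow_three_le_of_modulus`). [cite: Simon1986, §8 Thm. 5] -/
theorem stub_krCellCauchy :
    ∀ (T : ℝ) (F : ℕ → ℝ → EuclideanSpace ℂ (Fin 3)), 0 < T → (∀ n, Continuous (F n)) → (∀ Λ : ENNReal, 0 < Λ → ∃ δ : ℝ, 0 < δ ∧ ∀ (n : ℕ) (σ : ℝ), |σ| ≤ δ → ∫⁻ t in Set.Ioo 0 T, ‖F n (t + σ) - F n t‖ₑ ^ 3 ≤ Λ) → (∀ L l : ℕ, l ≤ L → ∃ c : EuclideanSpace ℂ (Fin 3), Filter.Tendsto (fun n => ∫ t in Set.Ioo ((l : ℝ) * (T / (L + 1))) ((l + 1 : ℝ) * (T / (L + 1))), F n t) Filter.atTop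 (nhds c)) → ∀ η : ENNReal, 0 < η → ∃ N : ℕ, ∀ n m : ℕ, N ≤ n → N ≤ m → ∫⁻ t in Set.Ioo 0 T, ‖F n t - F m t‖ₑ ^ 3 ≤ η :=
  fun _T _F hT hF hmod havg _η hη =>
    exists_forall_lintegral_enorm_sub_pow_three_le_of_modulus hT hF hmod havg hη

end Summit.AnomalousDissipation.AnomalousDissipation.Theorems.EulerLimitKR

end
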